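import Literature.RepresentationTheory.KonnoKonno2007.FockModelUnitaryDualPair
import Literature.Analysis.SegalBargmann.SchwartzCompactWeilDatum
import Literature.RepresentationTheory.CompactGroups.UnitaryGroupCharacters
import Literature.Analysis.SegalBargmann.SchwartzHeisenbergSchur
import HarnessLib

/-!
# Every archimedean Weil datum over a real unitary dual-pair junction has vacuum exponents

Topic `RepresentationTheory/KonnoKonno2007`; namespace `Literature.RepresentationTheory.KonnoKonno2007`.
KERNEL ONLY — no `def … : Prop` record, no new hypothesis structure; 0 new cited facts.

For a junction `D : RealDualPairJunction P Q R S Ginf` ([KonnoKonno2007, §3.1 p. 44 (3.1)]: an abstract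
`G_V × G_W` with its symplectic action `ι𝕎` on `𝕎 = V ⊗ W` in the tree's block coordinates and the inclusion
`κ` of the maximal compact `K_V × K_W = (U(P) × U(Q)) × (U(R) × U(S))`) and ANY archimedean Weil datum
`ω` over `D.ι𝕎` (tree notion `IsArchWeilDatum`: strongly continuous on `𝓢`, Heisenberg-covariant, unitary on `L²`),
the Gaussian `h_0 = hermitePi 0` is a joint eigenvector of `K_V × K_W` and the eigencharacter is a product of FOUR
DETERMINANT POWERS:

* §1 `exists_vacExponents_of_continuous`: every continuous unitary character of
  `(U(P) × U(Q)) × (U(R) × U(S))` is `((a,b),(c,d)) ↦ det a ^ e_P · det b ^ e_Q · det c ^ e_R · det d ^ e_S` for some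
  integer tuple `e : VacExponents` (the tree's classification `UnitaryGroupChar.exists_eq_detCircle_zpow` of the
  continuous characters of `U(n)`, [BröckerTomDieck1985, Ch. II Prop. 8.1], applied to the four factors; an empty
  factor contributes exponent `0`), and the tuple is unique when the four index types are nonempty
  (`vacExponents_unique`, via `UnitaryGroupChar.int_eq_of_det_zpow_eq`: two powers of `det` agreeing on `U(n)`, `n ≠ ∅`,
  have equal exponents);
* §2 `RealDualPairJunction.exists_vacExponents`: for every datum `ω` over `D.ι𝕎` there is `e : VacExponents` with
  `ω (κ k) h_0 = vacScalar e k • h_0` for all `k` — binder-2's `IsArchWeilDatum.exists_torus_weights` (on the maximal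
  compact a datum IS `compactWeilRep ι_K χ` for one continuous character `χ`, [Folland1989, Prop. (4.39)]) composed
  with §1; hence `RealDualPairJunction.exists_fockVacuumCharacter`: every datum witnesses the record
  `D.FockVacuumCharacter e` for SOME `e`, and `exists_fockVacuumCharacter_iff`:
  `(∃ e, D.FockVacuumCharacter e) ↔ ∃ ω, IsArchWeilDatum D.ι𝕎 ω`.

Reading for the model ledger (no record is added or changed here): the content of the record
`RealDualPairJunction.FockVacuumCharacter D e` ([KonnoKonno2007, Lemma 5.2 p. 73]) splits as
(a) EXISTENCE of an archimedean Weil datum over the junction and (b) the VALUES of the four exponents; by this file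
(a) alone already yields the record for some exponent tuple, and by `JunctionVacuumCirclePin` the difference
`e_P − e_Q` (and symmetrically `e_R − e_S`) of ANY such tuple is pinned by the junction's `SL₂`-frame, so only the
two remaining integers of (b) are data beyond (a).

References: [KonnoKonno2007] K. Konno, T. Konno, *On a lifting of automorphic representations of U(2,1) …*, §3.1,
§5.2, Lemma 5.2; [Folland1989] G. B. Folland, *Harmonic analysis in phase space*, Prop. (4.39);
[BröckerTomDieck1985] T. Bröcker, T. tom Dieck, *Representations of compact Lie groups*, Ch. II Prop. 8.1.
-/

noncomputable section

open Complex SchwartzMap Matrix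

namespace Literature.RepresentationTheory.KonnoKonno2007

open Literature.Analysis.SegalBargmann Literature.RepresentationTheory.HeisenbergGroup
open Literature.NumberTheory.Weil1964 Literature.RepresentationTheory.CompactGroups

variable {P Q R S : Type*} [Fintype P] [DecidableEq P] [Fintype Q] [DecidableEq Q] [Fintype R]
  [DecidableEq R] [Fintype S] [DecidableEq S]

/-! ## 1. Continuous characters of `(U(P) × U(Q)) × (U(R) × U(S))` are four determinant powers -/

namespace DPKChar

/-- the embedding `a ↦ ((a,1),(1,1))` of the factor `U(P)`. [folklore] -/
def inP : Matrix.unitaryGroup P ℂ →* DPK P Q R S := (MonoidHom.inl _ _).comp (MonoidHom.inl _ _)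
/-- the embedding `b ↦ ((1,b),(1,1))` of the factor `U(Q)`. [folklore] -/
def inQ : Matrix.unitaryGroup Q ℂ →* DPK P Q R S := (MonoidHom.inl _ _).comp (MonoidHom.inr _ _)
/-- the embedding `c ↦ ((1,1),(c,1))` of the factor `U(R)`. [folklore] -/
def inR : Matrix.unitaryGroup R ℂ →* DPK P Q R S := (MonoidHom.inr _ _).comp (MonoidHom.inl _ _)
/-- the embedding `d ↦ ((1,1),(1,d))` of the factor `U(S)`. [folklore] -/
def inS : Matrix.unitaryGroup S ℂ →* DPK P Q R S := (MonoidHom.inr _ _).comp (MonoidHom.inr _ _)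

/-- unfolding `inP`. [folklore] -/
@[simp] theorem inP_apply (a : Matrix.unitaryGroup P ℂ) : (inP a : DPK P Q R S) = ((a, 1), (1, 1)) := rfl
/-- unfolding `inQ`. [folklore] -/
@[simp] theorem inQ_apply (b : Matrix.unitaryGroup Q ℂ) : (inQ b : DPK P Q R S) = ((1, b), (1, 1)) := rfl
/-- unfolding `inR`. [folklore] -/
@[simp] theorem inR_apply (c : Matrix.unitaryGroup R ℂ) : (inR c : DPK P Q R S) = ((1, 1), (c, 1)) := rfl
/-- unfolding `inS`. [folklore] -/
@[simp] theorem inS_apply (d : Matrix.unitaryGroup S ℂ) : (inS d : DPK P Q R S) = ((1, 1), (1, d)) := rfl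

/-- `inP` is continuous. [folklore] -/
theorem continuous_inP : Continuous (inP : Matrix.unitaryGroup P ℂ → DPK P Q R S) :=
  (show Continuous fun a : Matrix.unitaryGroup P ℂ => (((a, 1), (1, 1)) : DPK P Q R S) by fun_prop).congr
    fun a => (inP_apply a).symm
/-- `inQ` is continuous. [folklore] -/
theorem continuous_inQ : Continuous (inQ : Matrix.unitaryGroup Q ℂ → DPK P Q R S) :=
  (show Continuous fun a : Matrix.unitaryGroup Q ℂ => (((1, a), (1, 1)) : DPK P Q R S) by fun_prop).congr
    fun a => (inQ_apply a).symm
/-- `inR` is continuous. [folklore] -/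
theorem continuous_inR : Continuous (inR : Matrix.unitaryGroup R ℂ → DPK P Q R S) :=
  (show Continuous fun a : Matrix.unitaryGroup R ℂ => (((1, 1), (a, 1)) : DPK P Q R S) by fun_prop).congr
    fun a => (inR_apply a).symm
/-- `inS` is continuous. [folklore] -/
theorem continuous_inS : Continuous (inS : Matrix.unitaryGroup S ℂ → DPK P Q R S) :=
  (show Continuous fun a : Matrix.unitaryGroup S ℂ => (((1, 1), (1, a)) : DPK P Q R S) by fun_prop).congr
    fun a => (inS_apply a).symm

/-- `((a,b),(c,d)) = inP a · inQ b · inR c · inS d`. [folklore] -/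
theorem eq_mul (k : DPK P Q R S) : k = inP k.1.1 * inQ k.1.2 * inR k.2.1 * inS k.2.2 := by
  ext <;> simp

end DPKChar

open DPKChar

/-- on the image of `inP` the determinant-power scalar is `det a ^ e_P`, and similarly for the other three
factors. [folklore] -/
@[simp] theorem vacScalar_inP (e : VacExponents) (a : Matrix.unitaryGroup P ℂ) :
    vacScalar e (inP a : DPK P Q R S) = (a : Matrix P P ℂ).det ^ e.eP := by
  simp [vacScalar]

/-- `vacScalar e (inQ b) = det b ^ e_Q`. [folklore] -/
@[simp] theorem vacScalar_inQ (e : VacExponents) (b : Matrix.unitaryGroup Q ℂ) :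
    vacScalar e (inQ b : DPK P Q R S) = (b : Matrix Q Q ℂ).det ^ e.eQ := by
  simp [vacScalar]

/-- `vacScalar e (inR c) = det c ^ e_R`. [folklore] -/
@[simp] theorem vacScalar_inR (e : VacExponents) (c : Matrix.unitaryGroup R ℂ) :
    vacScalar e (inR c : DPK P Q R S) = (c : Matrix R R ℂ).det ^ e.eR := by
  simp [vacScalar]

/-- `vacScalar e (inS d) = det d ^ e_S`. [folklore] -/
@[simp] theorem vacScalar_inS (e : VacExponents) (d : Matrix.unitaryGroup S ℂ) :
    vacScalar e (inS d : DPK P Q R S) = (d : Matrix S S ℂ).det ^ e.eS := by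
  simp [vacScalar]

/-- **Every continuous unitary character of `(U(P) × U(Q)) × (U(R) × U(S))` is a product of four determinant
powers**: `χ = vacCharCircle e` for some `e : VacExponents` (restriction to each factor is `det ^ m` by the
classification of continuous characters of `U(n)`; an empty factor is the trivial group and gets exponent `0`).
[cite: BrockerTomDieck1985, Ch. II Prop. 8.1 with Ch. IV (3.1)] [folklore] -/
theorem exists_vacExponents_of_continuous (χ : DPK P Q R S →* Circle) (hχ : Continuous χ) :
    ∃ e : VacExponents, ∀ k : DPK P Q R S, ((χ k : Circle) : ℂ) = vacScalar e k := by
  obtain ⟨mP, hP⟩ := UnitaryGroupChar.exists_eq_detCircle_zpow (χ.comp inP) (hχ.comp continuous_inP)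
  obtain ⟨mQ, hQ⟩ := UnitaryGroupChar.exists_eq_detCircle_zpow (χ.comp inQ) (hχ.comp continuous_inQ)
  obtain ⟨mR, hR⟩ := UnitaryGroupChar.exists_eq_detCircle_zpow (χ.comp inR) (hχ.comp continuous_inR)
  obtain ⟨mS, hS⟩ := UnitaryGroupChar.exists_eq_detCircle_zpow (χ.comp inS) (hχ.comp continuous_inS)
  refine ⟨⟨mP, mQ, mR, mS⟩, fun k => ?_⟩
  simp only [MonoidHom.coe_comp, Function.comp_apply] at hP hQ hR hS
  conv_lhs => rw [eq_mul k]
  simp only [map_mul, Circle.coe_mul, hP, hQ, hR, hS, Circle.coe_zpow, UnitaryGroupChar.coe_detCircle,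
    vacScalar, mul_assoc]

/-- … equivalently `χ = vacCharCircle e`. [cite: BrockerTomDieck1985, Ch. II Prop. 8.1 with Ch. IV (3.1)]
[folklore] -/
theorem exists_eq_vacCharCircle_of_continuous (χ : DPK P Q R S →* Circle) (hχ : Continuous χ) :
    ∃ e : VacExponents, χ = vacCharCircle e := by
  obtain ⟨e, he⟩ := exists_vacExponents_of_continuous χ hχ
  exact ⟨e, MonoidHom.ext fun k => Circle.ext (by rw [he, coe_vacCharCircle])⟩

/-- two integer powers of `det` that agree on all of `U(n)`, `n` nonempty, have equal exponents (uniqueness in the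
classification of the continuous characters of `U(n)`). [cite: BrockerTomDieck1985, Ch. II Prop. 8.1 with Ch. IV (3.1)]
[folklore] -/
theorem _root_.Literature.RepresentationTheory.CompactGroups.UnitaryGroupChar.int_eq_of_det_zpow_eq {n : Type*} [Fintype n] [DecidableEq n] [Nonempty n]
    {m m' : ℤ} (hmm : ∀ u : Matrix.unitaryGroup n ℂ, (u : Matrix n n ℂ).det ^ m = (u : Matrix n n ℂ).det ^ m') :
    m = m' := by
  have hc : Continuous fun u : Matrix.unitaryGroup n ℂ => (UnitaryGroupChar.detCircle u) ^ m :=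
    UnitaryGroupChar.continuous_detCircle.zpow m
  let χ : Matrix.unitaryGroup n ℂ →* Circle :=
    { toFun := fun u => UnitaryGroupChar.detCircle u ^ m
      map_one' := by simp
      map_mul' := fun u v => by rw [map_mul, mul_zpow] }
  obtain ⟨m₀, -, huniq⟩ := UnitaryGroupChar.existsUnique_eq_detCircle_zpow χ hc
  have h1 : m = m₀ := huniq m fun u => rfl
  have h2 : m' = m₀ := huniq m' fun u => Circle.ext (by
    change ((UnitaryGroupChar.detCircle u ^ m : Circle) : ℂ) = ((UnitaryGroupChar.detCircle u ^ m' : Circle) : ℂ)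
    rw [Circle.coe_zpow, Circle.coe_zpow, UnitaryGroupChar.coe_detCircle, hmm u])
  rw [h1, h2]

/-- **Uniqueness of the exponents** when all four index types are nonempty: the determinant-power scalars
determine `e`. [cite: BrockerTomDieck1985, Ch. II Prop. 8.1 with Ch. IV (3.1)] [folklore] -/
theorem vacExponents_unique [Nonempty P] [Nonempty Q] [Nonempty R] [Nonempty S] {e e' : VacExponents}
    (h : ∀ k : DPK P Q R S, vacScalar e k = vacScalar e' k) : e = e' := by
  obtain ⟨eP, eQ, eR, eS⟩ := e
  obtain ⟨eP', eQ', eR', eS'⟩ := e'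
  have hP : eP = eP' := UnitaryGroupChar.int_eq_of_det_zpow_eq fun a => by
    have h1 := h (inP a)
    rwa [vacScalar_inP, vacScalar_inP] at h1
  have hQ : eQ = eQ' := UnitaryGroupChar.int_eq_of_det_zpow_eq fun b => by
    have h1 := h (inQ b)
    rwa [vacScalar_inQ, vacScalar_inQ] at h1
  have hR : eR = eR' := UnitaryGroupChar.int_eq_of_det_zpow_eq fun c => by
    have h1 := h (inR c)
    rwa [vacScalar_inR, vacScalar_inR] at h1
  have hS : eS = eS' := UnitaryGroupChar.int_eq_of_det_zpow_eq fun d => by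
    have h1 := h (inS d)
    rwa [vacScalar_inS, vacScalar_inS] at h1
  rw [hP, hQ, hR, hS]

/-! ## 2. Every datum over a junction has vacuum exponents -/

variable {Ginf : Type*} [Group Ginf] [TopologicalSpace Ginf]

namespace RealDualPairJunction

/-- **Vacuum exponents of a datum.** For every archimedean Weil datum `ω` over the junction's `ι𝕎`, the maximal
compact `K_V × K_W` acts on the Gaussian `h_0` by a four-determinant-power character:
`ω (κ k) h_0 = vacScalar e k • h_0` for some `e : VacExponents` (on `K_V × K_W` the datum is `compactWeilRep ι_K χ`
for one continuous `χ`, whose vacuum eigenvalue is `χ k`; then §1). [cite: Folland1989, Prop (4.39)]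
[cite: BrockerTomDieck1985, Ch. II Prop. 8.1] [folklore] -/
theorem exists_vacExponents (D : RealDualPairJunction P Q R S Ginf)
    {ω : Representation ℂ Ginf (SchwartzMap (DPIdx P Q R S → ℝ) ℂ)} (hW : IsArchWeilDatum D.ι𝕎 ω) :
    ∃ e : VacExponents, ∀ k : DPK P Q R S, ω (D.κ k) (hermitePi 0) = vacScalar e k • hermitePi 0 := by
  obtain ⟨χ, hχ, -, h0⟩ := hW.exists_torus_weights D.κ D.κ_continuous dualPairι D.ι𝕎_κ
  obtain ⟨e, he⟩ := exists_vacExponents_of_continuous χ hχ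
  exact ⟨e, fun k => by rw [h0, he]⟩

/-- … with the exponents unique when the four blocks are nonempty. [cite: Folland1989, Prop (4.39)]
[cite: BrockerTomDieck1985, Ch. II Prop. 8.1] [folklore] -/
theorem existsUnique_vacExponents [Nonempty P] [Nonempty Q] [Nonempty R] [Nonempty S]
    (D : RealDualPairJunction P Q R S Ginf) {ω : Representation ℂ Ginf (SchwartzMap (DPIdx P Q R S → ℝ) ℂ)}
    (hW : IsArchWeilDatum D.ι𝕎 ω) :
    ∃! e : VacExponents, ∀ k : DPK P Q R S, ω (D.κ k) (hermitePi 0) = vacScalar e k • hermitePi 0 := by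
  obtain ⟨e, he⟩ := D.exists_vacExponents hW
  refine ⟨e, he, fun e' he' => vacExponents_unique (P := P) (Q := Q) (R := R) (S := S) fun k => ?_⟩
  have h := (he' k).symm.trans (he k)
  exact smul_left_injective ℂ (hermitePi_ne_zero (σ := DPIdx P Q R S) 0) h

/-- **Every datum witnesses the record `FockVacuumCharacter` for some exponent tuple.** [cite: KonnoKonno2007,
Lemma 5.2 (i)/(ii) p. 73 with §3.3 p. 47] [cite: Folland1989, Prop (4.39)] [folklore] -/
theorem exists_fockVacuumCharacter (D : RealDualPairJunction P Q R S Ginf)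
    {ω : Representation ℂ Ginf (SchwartzMap (DPIdx P Q R S → ℝ) ℂ)} (hW : IsArchWeilDatum D.ι𝕎 ω) :
    ∃ e : VacExponents, D.FockVacuumCharacter e :=
  let ⟨e, he⟩ := D.exists_vacExponents hW
  ⟨e, ω, hW, he⟩

/-- Hence: **the record holds for some exponent tuple iff an archimedean Weil datum over the junction exists at
all** — the record's content beyond existence is the value of the tuple. [cite: KonnoKonno2007, Lemma 5.2 (i)/(ii)
p. 73 with §3.3 p. 47] [folklore] -/
theorem exists_fockVacuumCharacter_iff (D : RealDualPairJunction P Q R S Ginf) :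
    (∃ e : VacExponents, D.FockVacuumCharacter e) ↔
      ∃ ω : Representation ℂ Ginf (SchwartzMap (DPIdx P Q R S → ℝ) ℂ), IsArchWeilDatum D.ι𝕎 ω :=
  ⟨fun ⟨_, h⟩ => h.exists_isArchWeilDatum, fun ⟨_, hW⟩ => D.exists_fockVacuumCharacter hW⟩

/-- When the four blocks are nonempty, two exponent tuples of the SAME datum coincide: if `ω` has the vacuum
clause for `e` and for `e'` then `e = e'`. [cite: BrockerTomDieck1985, Ch. II Prop. 8.1] [folklore] -/
theorem vacExponents_eq_of_vacuum_clause [Nonempty P] [Nonempty Q] [Nonempty R] [Nonempty S]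
    (D : RealDualPairJunction P Q R S Ginf) {ω : Representation ℂ Ginf (SchwartzMap (DPIdx P Q R S → ℝ) ℂ)}
    {e e' : VacExponents} (he : ∀ k : DPK P Q R S, ω (D.κ k) (hermitePi 0) = vacScalar e k • hermitePi 0)
    (he' : ∀ k : DPK P Q R S, ω (D.κ k) (hermitePi 0) = vacScalar e' k • hermitePi 0) : e = e' :=
  vacExponents_unique (P := P) (Q := Q) (R := R) (S := S) fun k =>
    smul_left_injective ℂ (hermitePi_ne_zero (σ := DPIdx P Q R S) 0) ((he k).symm.trans (he' k))

end RealDualPairJunction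

end Literature.RepresentationTheory.KonnoKonno2007

end
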